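import Mathlib
import HarnessLib
import Summits.ValiantsHypothesis.ValiantsHypothesis.Theorems.MonotoneRestorationMonotoneRestorationQPLinearWidthSubdividedWallGrid

/-!
# Route MonotoneRestoration, crux `MonotoneRestorationQP` (stmt-15886), line `linear_width` —
# LONG WALL-EDGE PATHS: concatenating the paths of a topological `5`-subdivided-wall minor

Helper file (`--supports stmt-ValiantsHypothesis-15886`), def-free.  Item (C) of the g15 residue list.

`SubdividedWallGrid.psubdivWall_isTopologicalMinor_of_grid_isMinor` puts `H_r = psubdiv (wall r) (fun _ => 5) 5` as a
topological minor into every graph with a `grid (6r) (6r)` minor.  The chain systems consumed by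
`CFIOddCover.widthRung_sqrt_of_chains` (p842034) want, for every WALL edge, ONE path of the host: the concatenation of the six
host paths of the six `H_r`-edges along it.  This file performs the concatenation once and for all:

* `isPath_append_of_inter` — appending two paths meeting only at the junction gives a path;
* `exists_concat_paths` — a chain of paths `P t : a t ⟶ a (t+1)` (`t < m`) in which consecutive paths meet only at their
  junction and non-consecutive ones are disjoint concatenates to a PATH `a 0 ⟶ a m` of length `≥ m` whose support is the
  union of the supports;
* **`exists_wallPaths_of_psubdivWall_topologicalMinor`** — from `H_r ≼ₜ F`: injective branch vertices `fv` for the wall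
  vertices and, for every wall edge `e` with chosen ends `(p, q) = edgeOut e`, a PATH `ω e : fv p ⟶ fv q` of `F` of LENGTH
  `≥ 6`, whose interior vertices are not branch vertices (I2) and avoid the other wall edges' paths (I3);
* `exists_wallPaths_of_grid_isMinor` — the same from a `grid (6r) (6r)` minor.

Honest label: combinatorial plumbing; no stub closed; θ₁, the cruxes and VP ≠ VNP NOT moved.
[cite: Diestel2010, §1.7 (subdivisions, topological minors); GalesiEtAl2023, §2 and Cor. 9]
-/

set_option linter.dupNamespace false

noncomputable section

open scoped Classical
open scoped Literature.Combinatorics.SimpleGraph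

namespace Summit.ValiantsHypothesis.ValiantsHypothesis.Theorems.CFIOddCover

open Literature.Combinatorics.SimpleGraph

/-! ### Concatenating paths -/

/-- Appending two paths that meet only at the junction gives a path. [folklore] -/
theorem isPath_append_of_inter {γ : Type*} {F : SimpleGraph γ} {a b c : γ} {p : F.Walk a b} {q : F.Walk b c}
    (hp : p.IsPath) (hq : q.IsPath) (h : ∀ x, x ∈ p.support → x ∈ q.support → x = b) : (p.append q).IsPath := by
  rw [SimpleGraph.Walk.isPath_def, SimpleGraph.Walk.support_append]
  rw [SimpleGraph.Walk.isPath_def] at hp hq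
  have hq' : q.support = b :: q.support.tail := (SimpleGraph.Walk.cons_tail_support q).symm
  rw [hq'] at hq
  refine List.Nodup.append hp (List.Nodup.of_cons hq) fun x hxp hxq => ?_
  have hxb : x = b := h x hxp (by rw [hq']; exact List.mem_cons_of_mem _ hxq)
  subst hxb
  exact (List.nodup_cons.1 hq).1 hxq

/-- **Concatenation of a chain of paths.**  Paths `P t : a t ⟶ a (t+1)` (`t < m`) such that `P s` and `P t` (`s < t`) share a
vertex only when `t = s + 1` and the vertex is the junction `a (s+1)` concatenate to a path `a 0 ⟶ a m` of length `≥ m`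
(if every `P t` has positive length) whose support is `{a 0} ∪ ⋃ support (P t)`. [folklore] -/
theorem exists_concat_paths {γ : Type*} {F : SimpleGraph γ} (a : ℕ → γ) (m : ℕ)
    (P : ∀ t, t < m → F.Walk (a t) (a (t + 1))) (hpath : ∀ t (ht : t < m), (P t ht).IsPath)
    (hlen : ∀ t (ht : t < m), 0 < (P t ht).length)
    (hjoint : ∀ s t (hs : s < m) (ht : t < m) x, s < t → x ∈ (P s hs).support → x ∈ (P t ht).support →
      t = s + 1 ∧ x = a (s + 1)) :
    ∃ ω : F.Walk (a 0) (a m), ω.IsPath ∧ m ≤ ω.length ∧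
      ∀ x, x ∈ ω.support ↔ x = a 0 ∨ ∃ t, ∃ ht : t < m, x ∈ (P t ht).support := by
  induction m with
  | zero =>
    refine ⟨SimpleGraph.Walk.nil, SimpleGraph.Walk.IsPath.nil, le_rfl, fun x => ?_⟩
    simp
  | succ m ih =>
    obtain ⟨ω, hω, hlenω, hsupp⟩ := ih (fun t ht => P t (Nat.lt_succ_of_lt ht)) (fun t ht => hpath t _)
      (fun t ht => hlen t _) (fun s t hs ht x hst hxs hxt => hjoint s t _ _ x hst hxs hxt)
    refine ⟨ω.append (P m (Nat.lt_succ_self m)), ?_, ?_, fun x => ?_⟩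
    · refine isPath_append_of_inter hω (hpath m _) fun x hxω hxm => ?_
      rcases (hsupp x).1 hxω with rfl | ⟨s, hs, hxs⟩
      · -- `a 0` lies on `P 0`
        rcases Nat.eq_zero_or_pos m with rfl | hm
        · rfl
        · have h0 : a 0 ∈ (P 0 (Nat.lt_succ_of_lt hm)).support := SimpleGraph.Walk.start_mem_support _
          obtain ⟨h1, h2⟩ := hjoint 0 m (Nat.lt_succ_of_lt hm) (Nat.lt_succ_self m) (a 0) hm h0 hxm
          rw [h2, ← h1]
      · obtain ⟨h1, h2⟩ := hjoint s m (Nat.lt_succ_of_lt hs) (Nat.lt_succ_self m) x hs hxs hxm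
        rw [h2, ← h1]
    · rw [SimpleGraph.Walk.length_append]
      have := hlen m (Nat.lt_succ_self m)
      omega
    · rw [SimpleGraph.Walk.mem_support_append_iff, hsupp]
      constructor
      · rintro ((rfl | ⟨t, ht, hx⟩) | hx)
        · exact Or.inl rfl
        · exact Or.inr ⟨t, Nat.lt_succ_of_lt ht, hx⟩
        · exact Or.inr ⟨m, Nat.lt_succ_self m, hx⟩
      · rintro (rfl | ⟨t, ht, hx⟩)
        · exact Or.inl (Or.inl rfl)
        · rcases Nat.lt_succ_iff_lt_or_eq.1 ht with ht' | rfl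
          · exact Or.inl (Or.inr ⟨t, ht', hx⟩)
          · exact Or.inr hx

/-! ### The long wall-edge paths -/

/-- **LONG WALL-EDGE PATHS FROM A TOPOLOGICAL `H_r`-MINOR.**  If `psubdiv (wall r) (fun _ => 5) 5 ≼ₜ F`, then there are
injective branch vertices `fv` for the wall vertices and, for every wall edge `e` (chosen ends `(p,q) = edgeOut e`), a path
`ω e : fv p ⟶ fv q` of `F` of length `≥ 6` such that (I2) no interior vertex of `ω e` is a branch vertex and (I3) interior
vertices of the paths of distinct wall edges are distinct. [cite: Diestel2010, §1.7 (subdivisions)] -/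
theorem exists_wallPaths_of_psubdivWall_topologicalMinor {γ : Type*} {F : SimpleGraph γ} {r : ℕ}
    (hH : psubdiv (wall r) (fun _ => 5) 5 ≼ₜ F) :
    ∃ (fv : Fin (r + 1) × Fin (r + 1) → γ), Function.Injective fv ∧
      ∃ ω : ∀ e, e ∈ (wall r).edgeSet → F.Walk (fv (edgeOut e).1) (fv (edgeOut e).2),
        (∀ e he, (ω e he).IsPath ∧ 6 ≤ (ω e he).length) ∧
        (∀ e he i, 0 < i → i < (ω e he).length → ∀ z, (ω e he).getVert i ≠ fv z) ∧
        (∀ e he e' he' i i', e ≠ e' → 0 < i → i < (ω e he).length → 0 < i' → i' < (ω e' he').length →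
          (ω e he).getVert i ≠ (ω e' he').getVert i') := by
  classical
  obtain ⟨f, P, hf, hpath, hbranch, hdisj⟩ := hH
  -- the `H`-path of a wall edge: `hv e 0 = inl p`, `hv e (j+1) = inr (e, j)` (`j < 5`), `hv e t = inl q` (`t ≥ 6`)
  let hv : ∀ e, e ∈ (wall r).edgeSet → ℕ → PSubdivVertex (wall r) (fun _ => 5) 5 := fun e he t =>
    if t = 0 then .inl (edgeOut e).1
    else if h : t ≤ 5 then .inr ⟨(e, ⟨t - 1, by omega⟩), he, by simp only; omega⟩
    else .inl (edgeOut e).2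
  have hv0 : ∀ e he, hv e he 0 = .inl (edgeOut e).1 := fun e he => by simp [hv]
  have hv6 : ∀ e he t, 6 ≤ t → hv e he t = .inl (edgeOut e).2 := fun e he t ht => by
    simp only [hv, show t ≠ 0 by omega, if_false, show ¬ t ≤ 5 by omega, dif_neg, not_false_eq_true]
  have hvmid : ∀ e he t (h1 : 1 ≤ t) (h5 : t ≤ 5),
      hv e he t = .inr ⟨(e, ⟨t - 1, by omega⟩), he, by simp only; omega⟩ := fun e he t h1 h5 => by
    simp only [hv, show t ≠ 0 by omega, if_false, dif_pos h5]
  -- consecutive vertices are adjacent in `H`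
  have hadjv : ∀ e he t, t < 6 → (psubdiv (wall r) (fun _ => 5) 5).Adj (hv e he t) (hv e he (t + 1)) := by
    intro e he t ht
    rcases Nat.eq_zero_or_pos t with rfl | ht0
    · rw [hv0 e he, hvmid e he 1 le_rfl (by norm_num), psubdiv_adj_inl_inr]
      exact Or.inl ⟨rfl, rfl⟩
    · by_cases ht5 : t + 1 ≤ 5
      · rw [hvmid e he t ht0 (by omega), hvmid e he (t + 1) (by omega) ht5, psubdiv_adj_inr_inr]
        exact ⟨rfl, Or.inl (by simp only; omega)⟩
      · have ht' : t = 5 := by omega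
        subst ht'
        rw [hvmid e he 5 (by norm_num) le_rfl, hv6 e he 6 le_rfl, psubdiv_adj_inr_inl]
        exact Or.inr ⟨rfl, by simp⟩
  -- which vertices of `H` occur on the path of `e`
  have hvshape : ∀ e he t, hv e he t = .inl (edgeOut e).1 ∨ hv e he t = .inl (edgeOut e).2 ∨
      ∃ (j : ℕ) (hj : j < 5), t = j + 1 ∧ hv e he t = .inr ⟨(e, ⟨j, hj⟩), he, hj⟩ := by
    intro e he t
    rcases Nat.eq_zero_or_pos t with rfl | ht0
    · exact Or.inl (hv0 e he)
    · by_cases h5 : t ≤ 5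
      · refine Or.inr (Or.inr ⟨t - 1, by omega, by omega, ?_⟩)
        rw [hvmid e he t ht0 h5]
      · exact Or.inr (Or.inl (hv6 e he t (by omega)))
  -- `hv e he` is injective on `[0, 6]`
  have hvinj : ∀ e he s t, s ≤ 6 → t ≤ 6 → hv e he s = hv e he t → s = t := by
    intro e he s t hs ht hst
    have hpq : (edgeOut e).1 ≠ (edgeOut e).2 := (adj_edgeOut he).ne
    rcases Nat.eq_zero_or_pos s with rfl | hs0 <;> rcases Nat.eq_zero_or_pos t with rfl | ht0
    · rfl
    · exfalso
      rw [hv0 e he] at hst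
      by_cases h5 : t ≤ 5
      · rw [hvmid e he t ht0 h5] at hst; exact Sum.inl_ne_inr hst
      · rw [hv6 e he t (by omega)] at hst; exact hpq (Sum.inl_injective hst)
    · exfalso
      rw [hv0 e he] at hst
      by_cases h5 : s ≤ 5
      · rw [hvmid e he s hs0 h5] at hst; exact Sum.inr_ne_inl hst
      · rw [hv6 e he s (by omega)] at hst; exact hpq (Sum.inl_injective hst).symm
    · by_cases hs5 : s ≤ 5 <;> by_cases ht5 : t ≤ 5
      · rw [hvmid e he s hs0 hs5, hvmid e he t ht0 ht5] at hst
        have := congrArg (fun x : PSubdivVertex (wall r) (fun _ => 5) 5 =>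
          match x with | .inr y => (y.1.2 : ℕ) | .inl _ => 0) hst
        simp only at this
        omega
      · rw [hvmid e he s hs0 hs5, hv6 e he t (by omega)] at hst; exact absurd hst Sum.inr_ne_inl
      · rw [hv6 e he s (by omega), hvmid e he t ht0 ht5] at hst; exact absurd hst Sum.inl_ne_inr
      · omega
  -- the pieces
  let Pe : ∀ e (he : e ∈ (wall r).edgeSet) (t : ℕ), t < 6 → F.Walk (f (hv e he t)) (f (hv e he (t + 1))) :=
    fun e he t ht => P _ _ (hadjv e he t ht)
  -- pieces of distinct `H`-edges meet only in branch vertices, and then only at common ends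
  have hmeet : ∀ e he e' he' s t (hs : s < 6) (ht : t < 6) x,
      s(hv e he s, hv e he (s + 1)) ≠ s(hv e' he' t, hv e' he' (t + 1)) →
      x ∈ (Pe e he s hs).support → x ∈ (Pe e' he' t ht).support →
      ∃ w, f w = x ∧ (w = hv e he s ∨ w = hv e he (s + 1)) ∧ (w = hv e' he' t ∨ w = hv e' he' (t + 1)) := by
    intro e he e' he' s t hs ht x hne hxs hxt
    obtain ⟨w, rfl⟩ := hdisj _ _ _ _ (hadjv e he s hs) (hadjv e' he' t ht) hne x hxs hxt
    exact ⟨w, rfl, hbranch _ _ _ w hxs, hbranch _ _ _ w hxt⟩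
  -- concatenate along every wall edge
  have hconcat : ∀ e (he : e ∈ (wall r).edgeSet), ∃ ω : F.Walk (f (hv e he 0)) (f (hv e he 6)),
      ω.IsPath ∧ 6 ≤ ω.length ∧
      ∀ x, x ∈ ω.support ↔ x = f (hv e he 0) ∨ ∃ t, ∃ ht : t < 6, x ∈ (Pe e he t ht).support := by
    intro e he
    refine exists_concat_paths (fun t => f (hv e he t)) 6 (Pe e he) (fun t ht => hpath _ _ _) (fun t ht => ?_)
      (fun s t hs ht x hst hxs hxt => ?_)
    · -- positive length: the ends are distinct
      rw [Nat.pos_iff_ne_zero]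
      intro h0
      have := SimpleGraph.Walk.eq_of_length_eq_zero h0
      have hst := hvinj e he t (t + 1) (by omega) (by omega) (hf this)
      omega
    · -- consecutive pieces meet at the junction only; others are disjoint
      have hne : s(hv e he s, hv e he (s + 1)) ≠ s(hv e he t, hv e he (t + 1)) := by
        intro heq
        rcases Sym2.eq_iff.1 heq with ⟨h1, -⟩ | ⟨h1, h2⟩
        · have := hvinj e he s t (by omega) (by omega) h1; omega
        · have := hvinj e he s (t + 1) (by omega) (by omega) h1; omega
      obtain ⟨w, hw, hws, hwt⟩ := hmeet e he e he s t hs ht x hne hxs hxt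
      rcases hws with rfl | rfl <;> rcases hwt with h | h
      · have := hvinj e he s t (by omega) (by omega) h; omega
      · have := hvinj e he s (t + 1) (by omega) (by omega) h; omega
      · have := hvinj e he (s + 1) t (by omega) (by omega) h
        exact ⟨by omega, hw.symm⟩
      · have := hvinj e he (s + 1) (t + 1) (by omega) (by omega) h; omega
  choose ω hω using hconcat
  -- (I2): an interior vertex of `ω e` is not the branch vertex of a wall vertex
  have hI2 : ∀ e he i, 0 < i → i < (ω e he).length → ∀ z, (ω e he).getVert i ≠ f (.inl z) := by
    intro e he i hi0 hi z heq
    have hmem : f (.inl z) ∈ (ω e he).support := heq ▸ SimpleGraph.Walk.getVert_mem_support _ _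
    -- a branch vertex `f (inl z)` on `ω e` is one of its two ends
    have hend : f (Sum.inl z) = f (hv e he 0) ∨ f (Sum.inl z) = f (hv e he 6) := by
      rcases ((hω e he).2.2 _).1 hmem with h0 | ⟨t, ht, hxt⟩
      · exact Or.inl h0
      · rcases hbranch _ _ _ (.inl z) hxt with hz | hz
        · rcases hvshape e he t with h | h | ⟨j, hj, -, h⟩
          · exact Or.inl (by rw [hz, h, hv0 e he])
          · exact Or.inr (by rw [hz, h, hv6 e he 6 le_rfl])
          · rw [h] at hz; exact absurd hz Sum.inl_ne_inr
        · rcases hvshape e he (t + 1) with h | h | ⟨j, hj, -, h⟩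
          · exact Or.inl (by rw [hz, h, hv0 e he])
          · exact Or.inr (by rw [hz, h, hv6 e he 6 le_rfl])
          · rw [h] at hz; exact absurd hz Sum.inl_ne_inr
    rcases hend with h | h
    · have h00 : (ω e he).getVert i = (ω e he).getVert 0 := by
        rw [heq, h, SimpleGraph.Walk.getVert_zero]
      have := (hω e he).1.getVert_injOn (by simp; omega) (by simp) h00
      omega
    · have hLL : (ω e he).getVert i = (ω e he).getVert (ω e he).length := by
        rw [heq, h, SimpleGraph.Walk.getVert_length]
      have := (hω e he).1.getVert_injOn (by simp; omega) (by simp) hLL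
      omega
  -- an inner vertex of the `e`-path is not a vertex of the `e'`-path, `e ≠ e'`
  have hcross : ∀ e he e' he', e ≠ e' → ∀ (j : ℕ) (hj : j < 5) (b : ℕ),
      (Sum.inr ⟨(e, ⟨j, hj⟩), he, hj⟩ : PSubdivVertex (wall r) (fun _ => 5) 5) ≠ hv e' he' b := by
    intro e he e' he' hne j hj b hab
    rcases hvshape e' he' b with h | h | ⟨j', hj', -, h⟩
    · rw [h] at hab; exact Sum.inr_ne_inl hab
    · rw [h] at hab; exact Sum.inr_ne_inl hab
    · rw [h] at hab
      have := congrArg (fun y : PSubdivVertex (wall r) (fun _ => 5) 5 =>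
        match y with | .inr y => y.1.1 | .inl _ => e) hab
      exact hne this
  -- among two consecutive vertices of the `e`-path one is inner
  have hinner2 : ∀ e he t, t < 6 →
      ∃ a, (a = t ∨ a = t + 1) ∧ ∃ (j : ℕ) (hj : j < 5), hv e he a = .inr ⟨(e, ⟨j, hj⟩), he, hj⟩ := by
    intro e he t ht
    rcases Nat.eq_zero_or_pos t with rfl | ht0
    · exact ⟨1, Or.inr rfl, 0, by norm_num, hvmid e he 1 le_rfl (by norm_num)⟩
    · exact ⟨t, Or.inl rfl, t - 1, by omega, by rw [hvmid e he t ht0 (by omega)]⟩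
  -- (I3): interior vertices of the paths of distinct wall edges are distinct
  have hI3 : ∀ e he e' he' i i', e ≠ e' → 0 < i → i < (ω e he).length → 0 < i' → i' < (ω e' he').length →
      (ω e he).getVert i ≠ (ω e' he').getVert i' := by
    intro e he e' he' i i' hne hi0 hi hi0' hi' heq
    set x := (ω e he).getVert i with hx
    have hmem : x ∈ (ω e he).support := SimpleGraph.Walk.getVert_mem_support _ _
    have hmem' : x ∈ (ω e' he').support := heq ▸ SimpleGraph.Walk.getVert_mem_support _ _
    have hon : ∃ t, ∃ ht : t < 6, x ∈ (Pe e he t ht).support := by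
      rcases ((hω e he).2.2 x).1 hmem with h0 | h
      · exact ⟨0, by norm_num, by rw [h0]; exact SimpleGraph.Walk.start_mem_support _⟩
      · exact h
    have hon' : ∃ t, ∃ ht : t < 6, x ∈ (Pe e' he' t ht).support := by
      rcases ((hω e' he').2.2 x).1 hmem' with h0 | h
      · exact ⟨0, by norm_num, by rw [h0]; exact SimpleGraph.Walk.start_mem_support _⟩
      · exact h
    obtain ⟨t, ht, hxt⟩ := hon
    obtain ⟨t', ht', hxt'⟩ := hon'
    -- the two `H`-edges differ
    have hne' : s(hv e he t, hv e he (t + 1)) ≠ s(hv e' he' t', hv e' he' (t' + 1)) := by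
      intro hst
      obtain ⟨a, ha, hja⟩ := hinner2 e he t ht
      obtain ⟨j, hj, hja⟩ := hja
      rcases Sym2.eq_iff.1 hst with ⟨h1, h2⟩ | ⟨h1, h2⟩
      · rcases ha with rfl | rfl
        · exact hcross e he e' he' hne j hj _ (by rw [← hja]; exact h1)
        · exact hcross e he e' he' hne j hj _ (by rw [← hja]; exact h2)
      · rcases ha with rfl | rfl
        · exact hcross e he e' he' hne j hj _ (by rw [← hja]; exact h1)
        · exact hcross e he e' he' hne j hj _ (by rw [← hja]; exact h2)
    obtain ⟨w, hw, hwe, hwe'⟩ := hmeet e he e' he' t t' ht ht' x hne' hxt hxt'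
    -- `w` on the `e`-path: a wall-vertex end (contradicting (I2)) or an inner vertex of `e` (not on the `e'`-path)
    have hwshape : (∃ z, w = Sum.inl z) ∨ ∃ (j : ℕ) (hj : j < 5), w = .inr ⟨(e, ⟨j, hj⟩), he, hj⟩ := by
      rcases hwe with hw1 | hw1
      · rcases hvshape e he t with h | h | ⟨j, hj, -, h⟩
        · exact Or.inl ⟨_, hw1.trans h⟩
        · exact Or.inl ⟨_, hw1.trans h⟩
        · exact Or.inr ⟨j, hj, hw1.trans h⟩
      · rcases hvshape e he (t + 1) with h | h | ⟨j, hj, -, h⟩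
        · exact Or.inl ⟨_, hw1.trans h⟩
        · exact Or.inl ⟨_, hw1.trans h⟩
        · exact Or.inr ⟨j, hj, hw1.trans h⟩
    rcases hwshape with ⟨z, hz⟩ | ⟨j, hj, hwj⟩
    · exact hI2 e he i hi0 hi z (by rw [← hx, ← hw, hz])
    · rcases hwe' with hb | hb
      · exact hcross e he e' he' hne j hj t' (by rw [← hwj]; exact hb)
      · exact hcross e he e' he' hne j hj (t' + 1) (by rw [← hwj]; exact hb)
  refine ⟨fun z => f (.inl z), fun z z' h => Sum.inl_injective (hf h),
    fun e he => (ω e he).copy (congrArg f (hv0 e he)) (congrArg f (hv6 e he 6 le_rfl)), fun e he => ?_, ?_, ?_⟩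
  · refine ⟨(SimpleGraph.Walk.isPath_copy _ _ _).2 (hω e he).1, ?_⟩
    rw [SimpleGraph.Walk.length_copy]; exact (hω e he).2.1
  · intro e he i hi0 hi z
    rw [SimpleGraph.Walk.length_copy] at hi
    rw [SimpleGraph.Walk.getVert_copy]
    exact hI2 e he i hi0 hi z
  · intro e he e' he' i i' hne hi0 hi hi0' hi'
    rw [SimpleGraph.Walk.length_copy] at hi hi'
    rw [SimpleGraph.Walk.getVert_copy, SimpleGraph.Walk.getVert_copy]
    exact hI3 e he e' he' i i' hne hi0 hi hi0' hi'

/-- **LONG WALL-EDGE PATHS FROM A GRID MINOR**: `grid (6r) (6r) ≼ₘ F` gives the same conclusion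
(`psubdivWall_isTopologicalMinor_of_grid_isMinor`). [cite: GalesiEtAl2023, Cor. 9; Diestel2010, Prop. 1.7.2 (ii)] -/
theorem exists_wallPaths_of_grid_isMinor {γ : Type*} {F : SimpleGraph γ} {r : ℕ} (hF : grid (6 * r) (6 * r) ≼ₘ F) :
    ∃ (fv : Fin (r + 1) × Fin (r + 1) → γ), Function.Injective fv ∧
      ∃ ω : ∀ e, e ∈ (wall r).edgeSet → F.Walk (fv (edgeOut e).1) (fv (edgeOut e).2),
        (∀ e he, (ω e he).IsPath ∧ 6 ≤ (ω e he).length) ∧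
        (∀ e he i, 0 < i → i < (ω e he).length → ∀ z, (ω e he).getVert i ≠ fv z) ∧
        (∀ e he e' he' i i', e ≠ e' → 0 < i → i < (ω e he).length → 0 < i' → i' < (ω e' he').length →
          (ω e he).getVert i ≠ (ω e' he').getVert i') :=
  exists_wallPaths_of_psubdivWall_topologicalMinor (psubdivWall_isTopologicalMinor_of_grid_isMinor hF)

end Summit.ValiantsHypothesis.ValiantsHypothesis.Theorems.CFIOddCover

end
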